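import Mathlib
import HarnessLib
import Summits.HubbardSuperconductivity.HubbardSuperconductivity.Theorems.KLProgrammeKLRegimeTwoVolumeLipDiffDefs
import Summits.HubbardSuperconductivity.HubbardSuperconductivity.Theorems.KLProgrammeKLRegimeTwoVolumeTorusBlocks

/-!
# Route `KLProgramme` — crux K3 ENGINE (stmt-HubbardSuperconductivity-20437), stub (e) proof-input «(e)-D-ROWS», (M1): THE DEEP-PIN SUPREMA AS THE
# PROFILES `E`, `ND` OF THE BLOCK CHAIN
# (seat hubbard-kl-k3c4-p1 g23; `--supports` 20437; DROWS-SCOPE-g23 v5 §9.4 (M1))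

The block chain of the two-volume Lipschitz tower (`…LipSourceTransfer.sum_pinned_norm_kernel_klLipBornDiff_le_of_parts`,
`…LipRemeasure.sum_pinned_norm_kernel_klLipInputDiff_le_of_parts`, `…LipChainRows`) reads the two-volume differences through TWO profiles per degree: `E` —
the pinned sums at pins within `r` of a deep output pin — and `ND` — the pinned sums at every pin.  (M1) of the memo names them as the deep-pin suprema of
`…TwoVolumeLipDiffDefs` (`klLipInputDiffSup / klLipBornDiffSup … d k m R`).  This file supplies the three bookkeeping facts that make that reading literal:

* `mem_klDeepPins_zero` — every label is `0`-deep (so `ND := klLip…DiffSup … m 0`); `mem_klDeepPins_of_tnorm_le` — a label within torus distance `r` of a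
  `(D + r)`-deep label is `D`-deep (residue arithmetic of `…TwoVolumeTorusBlocks.far_of_not_deep_of_deep`; so `E := klLip…DiffSup … m D`);
* `klLipInputDiffSup_le_of_forall`, `klLipBornDiffSup_le_of_forall` — the suprema are bounded by any common nonnegative bound of the pinned sums (the
  direction the recursion needs: a pin-level bound at every deep pin IS a bound of the sup);
* `sum_pinned_norm_kernel_bornDiff_le_sup_of_near / _le_sup_zero`, `sum_pinned_norm_kernel_inputDiff_le_sup_of_near / _le_sup_zero` — the `hE` / `hND`
  hypotheses of the transfer doors discharged by the suprema.

Pure bookkeeping; nothing asserts the (D) rows, stub (e), VL, K3 or superconductivity.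
-/

namespace Summit.HubbardSuperconductivity.HubbardSuperconductivity.Theorems.TwoVolumeLip

set_option linter.dupNamespace false -- summit = problem name (single-conjunct summit), D-0017

open Finset Literature.MathematicalPhysics.QuantumLattice GrassmannAlgebra Literature.Probability.LatticeModels
open Summit.HubbardSuperconductivity.HubbardSuperconductivity.Theorems.TwoVolumeSource
open Summit.HubbardSuperconductivity.HubbardSuperconductivity.Theorems.TwoVolumeDefect

noncomputable section

/-! ## §1 Depth bookkeeping -/

section Depth

variable {V M : ℕ} [NeZero V]

/-- **Every label is `0`-deep.** [folklore] -/
theorem mem_klDeepPins_zero {N : ℕ} (L : ℕ) [NeZero L] (x : SpaceTimeIdx V M × SectorLeg N) : x ∈ klDeepPins L 0 :=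
  mem_klDeepPins.2 fun j => ⟨Nat.zero_le _, by rw [add_zero]; exact Nat.mod_lt _ (NeZero.pos L)⟩

/-- **A label within torus distance `r` of a `(D + r)`-deep label is `D`-deep** (fine torus `(ℤ/(bL)ℤ)²` tiled by boxes of side `L`). [folklore] -/
theorem mem_klDeepPins_of_tnorm_le {L b N₁ N₂ D r : ℕ} [NeZero L] [NeZero (b * L)]
    {w : SpaceTimeIdx (b * L) M × SectorLeg N₂} {y : SpaceTimeIdx (b * L) M × SectorLeg N₁}
    (hw : ∀ j, D + r ≤ (w.1.2 j).val % L ∧ (w.1.2 j).val % L + (D + r) < L) (hy : Torus.tnorm (w.1.2 - y.1.2) ≤ r) :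
    y ∈ klDeepPins L D := by
  refine mem_klDeepPins.2 ?_
  by_contra hc
  have hfar : r < Torus.tnorm (y.1.2 - w.1.2) := far_of_not_deep_of_deep (d := 2) (M := b * L) (m := L) (b := b) rfl hc hw
  rw [← Torus.tnorm_neg, neg_sub] at hfar
  exact absurd hy (not_le.2 hfar)

end Depth

/-! ## §2 The suprema from pin-level bounds, and as the profiles `E`, `ND` -/

section Sups

variable {L b M : ℕ} [NeZero L] [NeZero (b * L)]

/-- **The deep-pin size of the measured difference is at most any common nonnegative bound of the pinned sums at deep pins.** -/
theorem klLipInputDiffSup_le_of_forall (β U μ : ℝ) (K : TrigPolyC4v) (d k m R : ℕ) {B : ℝ} (hB : 0 ≤ B)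
    (h : ∀ (q : Fin m) (w : SpaceTimeIdx (b * L) M × SectorLeg (sectorCount (d * k - 1))), w ∈ klDeepPins L R →
      ∑ X ∈ univ.filter (fun X : Fin m → SpaceTimeIdx (b * L) M × SectorLeg (sectorCount (d * k - 1)) => X q = w),
        ‖kernel ℂ (klLipInputDiff L b M β U μ K d k) m X‖ ≤ B) :
    klLipInputDiffSup L b M β U μ K d k m R ≤ B := by
  unfold klLipInputDiffSup
  rcases isEmpty_or_nonempty (Fin m × {w : SpaceTimeIdx (b * L) M × SectorLeg (sectorCount (d * k - 1)) // w ∈ klDeepPins L R}) with h' | h'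
  · rw [Real.iSup_of_isEmpty]; exact hB
  · exact ciSup_le fun qw => h qw.1 qw.2.1 qw.2.2

/-- **The deep-pin size of the born difference is at most any common nonnegative bound of the pinned sums at deep pins.** -/
theorem klLipBornDiffSup_le_of_forall (β U μ : ℝ) (K : TrigPolyC4v) (d k m R : ℕ) {B : ℝ} (hB : 0 ≤ B)
    (h : ∀ (q : Fin m) (w : SpaceTimeIdx (b * L) M × SectorLeg (sectorCount (d * k))), w ∈ klDeepPins L R →
      ∑ X ∈ univ.filter (fun X : Fin m → SpaceTimeIdx (b * L) M × SectorLeg (sectorCount (d * k)) => X q = w),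
        ‖kernel ℂ (klLipBornDiff L b M β U μ K d k) m X‖ ≤ B) :
    klLipBornDiffSup L b M β U μ K d k m R ≤ B := by
  unfold klLipBornDiffSup
  rcases isEmpty_or_nonempty (Fin m × {w : SpaceTimeIdx (b * L) M × SectorLeg (sectorCount (d * k)) // w ∈ klDeepPins L R}) with h' | h'
  · rw [Real.iSup_of_isEmpty]; exact hB
  · exact ciSup_le fun qw => h qw.1 qw.2.1 qw.2.2


/-- **`hE` of the transfer doors from the deep-pin size**: at a pin within `r` of a `(D + r)`-deep output pin, the pinned sum of the born difference of block
`k` is at most `klLipBornDiffSup … (D)`. -/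
theorem sum_pinned_norm_kernel_bornDiff_le_sup_of_near (β U μ : ℝ) (K : TrigPolyC4v) (d k : ℕ) {m : ℕ} (q : Fin m) {N₂ D r : ℕ}
    {w' : SpaceTimeIdx (b * L) M × SectorLeg N₂} (hw : ∀ j, D + r ≤ (w'.1.2 j).val % L ∧ (w'.1.2 j).val % L + (D + r) < L)
    (y' : SpaceTimeIdx (b * L) M × SectorLeg (sectorCount (d * k))) (hy : Torus.tnorm (w'.1.2 - y'.1.2) ≤ r) :
    ∑ X ∈ univ.filter (fun X : Fin m → SpaceTimeIdx (b * L) M × SectorLeg (sectorCount (d * k)) => X q = y'),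
        ‖kernel ℂ (klLipBornDiff L b M β U μ K d k) m X‖ ≤ klLipBornDiffSup L b M β U μ K d k m D :=
  sum_pinned_norm_kernel_bornDiff_le_sup β U μ K d k m D q (mem_klDeepPins_of_tnorm_le hw hy)

/-- **`hND` of the transfer doors from the size at depth `0`**: every pinned sum of the born difference of block `k` is at most `klLipBornDiffSup … 0`. -/
theorem sum_pinned_norm_kernel_bornDiff_le_sup_zero (β U μ : ℝ) (K : TrigPolyC4v) (d k : ℕ) {m : ℕ} (q : Fin m)
    (y' : SpaceTimeIdx (b * L) M × SectorLeg (sectorCount (d * k))) :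
    ∑ X ∈ univ.filter (fun X : Fin m → SpaceTimeIdx (b * L) M × SectorLeg (sectorCount (d * k)) => X q = y'),
        ‖kernel ℂ (klLipBornDiff L b M β U μ K d k) m X‖ ≤ klLipBornDiffSup L b M β U μ K d k m 0 :=
  sum_pinned_norm_kernel_bornDiff_le_sup β U μ K d k m 0 q (mem_klDeepPins_zero L y')

/-- **`hE`-type reading of the measured difference**: at a pin within `r` of a `(D + r)`-deep label, the pinned sum of the measured difference of block `k`
is at most `klLipInputDiffSup … (D)`. -/
theorem sum_pinned_norm_kernel_inputDiff_le_sup_of_near (β U μ : ℝ) (K : TrigPolyC4v) (d k : ℕ) {m : ℕ} (q : Fin m) {N₂ D r : ℕ}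
    {w' : SpaceTimeIdx (b * L) M × SectorLeg N₂} (hw : ∀ j, D + r ≤ (w'.1.2 j).val % L ∧ (w'.1.2 j).val % L + (D + r) < L)
    (y' : SpaceTimeIdx (b * L) M × SectorLeg (sectorCount (d * k - 1))) (hy : Torus.tnorm (w'.1.2 - y'.1.2) ≤ r) :
    ∑ X ∈ univ.filter (fun X : Fin m → SpaceTimeIdx (b * L) M × SectorLeg (sectorCount (d * k - 1)) => X q = y'),
        ‖kernel ℂ (klLipInputDiff L b M β U μ K d k) m X‖ ≤ klLipInputDiffSup L b M β U μ K d k m D :=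
  sum_pinned_norm_kernel_inputDiff_le_sup β U μ K d k m D q (mem_klDeepPins_of_tnorm_le hw hy)

/-- **`hND`-type reading of the measured difference**: every pinned sum of the measured difference of block `k` is at most `klLipInputDiffSup … 0`. -/
theorem sum_pinned_norm_kernel_inputDiff_le_sup_zero (β U μ : ℝ) (K : TrigPolyC4v) (d k : ℕ) {m : ℕ} (q : Fin m)
    (y' : SpaceTimeIdx (b * L) M × SectorLeg (sectorCount (d * k - 1))) :
    ∑ X ∈ univ.filter (fun X : Fin m → SpaceTimeIdx (b * L) M × SectorLeg (sectorCount (d * k - 1)) => X q = y'),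
        ‖kernel ℂ (klLipInputDiff L b M β U μ K d k) m X‖ ≤ klLipInputDiffSup L b M β U μ K d k m 0 :=
  sum_pinned_norm_kernel_inputDiff_le_sup β U μ K d k m 0 q (mem_klDeepPins_zero L y')

end Sups

end

end Summit.HubbardSuperconductivity.HubbardSuperconductivity.Theorems.TwoVolumeLip
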